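import Summits.HubbardSuperconductivity.HubbardLadder.Bounds.AttractivePairBreakingFloor
import Literature.MathematicalPhysics.QuantumLattice.HubbardDoubleOccupancyBounds
import HarnessLib

/-!
# Attractive Hubbard model on ANY bounded-degree graph: `⟨-T⟩_ψ ≤ 16 Δ² t² m/|U|`

pub-hubbard cell, bounds seat (bounds.tex Theorem 9(ii′); BOUNDS.md §1 row T7). HONEST FRAMING:
ladder R1–R4 with certified numbers; no claim on H/H₀. Bounds for a MODEL CLASS (the attractive
Hubbard model `hamiltonian G t U`, `U < 0`, on an arbitrary finite simple graph `G` of maximal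
degree `≤ Δ`); no materials claim.

The square-torus kinetic ceiling `⟨-T⟩_ψ ≤ 256 m t²/|U|` of
`Bounds/AttractiveStiffnessCeilingDensity.lean` uses only three graph-independent inputs: the
pair-breaking counting floor `E ≥ -|t| Δ ω N` of `Bounds/AttractivePairBreakingFloor.lean`
(`pairBreaking_le_minEnergyOn_szSector`, any graph of maximal degree `≤ Δ`), the fully paired
product configuration (`E(U; m↑, m↓) ≤ U m`), and the tight chord at `U₁ = U/2` (Rayleigh–Ritz
with the ground state of `H_U` as trial vector for `H_{U/2} = H_U + (U/2 - U) D`). This file runs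
the same three steps on an arbitrary finite graph:

* (reused from the tree: `DoubleOccupancy.hamiltonian_eq_add_smul` of
  `HubbardDoubleOccupancyBounds.lean`, `H(t,U₁) = H(t,U) + (U₁ - U)·Σ_x n_{x↑}n_{x↓}`);
* `star_single_pairSet_self_hamiltonian`, `minEnergyOn_szSector_two_mul_le` : the paired
  configuration `|A↑ ∪ A↓⟩`, `#A = m ≤ |Λ|`, has energy `U m`, so `E(U; 2m, S^z = 0) ≤ U m`;
* `neg_re_expect_hopping_le_of_weight` (parametric): for `ω ≥ 1` with
  `|t| Δ (2ω - 2ω⁻¹) ≥ -U/2`, every unit ground state `ψ` of `H_U` in the sector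
  `(2m, S^z = 0)` has `⟨-T⟩_ψ := -Re⟨ψ, H(t,0) ψ⟩ ≤ m (4|t| Δ ω + U)`;
* `neg_re_expect_hopping_le_attractive_graph` (closed form, `ω = a + a⁻¹`, `a = |U|/(4|t|Δ)`):
  `⟨-T⟩_ψ ≤ 16 Δ² t² m/|U| = 8 Δ² t² N/|U|`; node `AttractiveKineticCeilingGraph` + `_holds`;
* `neg_re_expect_hopping_le_attractive_torus` : the square torus (`Δ = 4`, `t = 1`) recovers
  the constant `256 m/|U|` of `AttractiveKineticCeilingDensity`.

HONEST NUMBERS. Every `N`-particle unit vector has `|⟨T⟩| ≤ |t| Δ N` (the counting floor at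
`ω = 1`), so the theorem carries information only for `|U| > 8 Δ |t|` (square lattice:
`|U| > 32 t`), deep on the BEC side, where second-order perturbation theory gives
`⟨-T⟩ ≈ (pair delocalisation with hopping 2t²/|U|) + (virtual breaking 2Δt²/|U| per pair)`, i.e.
`O(Δ t² N/|U|)`: the constant `8 Δ²` is loose by a factor `≈ 4Δ`. What is gained is the CLASS:
every finite graph of bounded degree, every pair number; no translation invariance, no
bipartiteness, no reflection positivity, no numerics.

References (`lean/references.bib`): Nagaoka1966 §II (hole counting, the mirrored mechanism);
LiebPRL1989 (sectors); HazraVermaRanderia2019 App. G (the `t²/|U|` BEC-side estimate,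
approximate there); MicnasRanningerRobaszkiewicz1990 §IV (strong-coupling picture).
-/

noncomputable section

namespace Summit.HubbardSuperconductivity.HubbardLadder.Bounds

open Matrix Finset Real
open Literature.MathematicalPhysics.QuantumLattice
open Literature.MathematicalPhysics.QuantumFieldTheory
open Literature.Probability.LatticeModels
open scoped ComplexOrder ComplexConjugate

section Graph

variable {Λ : Type*} [LinearOrder Λ] [Fintype Λ] (G : SimpleGraph Λ) [DecidableRel G.Adj]

/-- For a unit ground state `ψ` of `H` in the sector `(N, M)`: `Re⟨ψ, Hψ⟩ = E(N, M)`. -/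
theorem re_expect_eq_minEnergyOn_of_isGroundStateInSector
    {H : Matrix (Finset (Orb Λ)) (Finset (Orb Λ)) ℂ} {N : ℕ} {M : ℝ} {ψ : Fock (Orb Λ)}
    (hgs : IsGroundStateInSector H N M ψ) (h1 : star ψ ⬝ᵥ ψ = 1) :
    (star ψ ⬝ᵥ (H *ᵥ ψ)).re = H.minEnergyOn (szSector N M) := by
  rw [hgs.2.2, dotProduct_smul, h1, smul_eq_mul, mul_one, Complex.ofReal_re]

/-- **The fully paired configuration `|A↑ ∪ A↓⟩` has energy exactly `U · #A`** on any graph and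
for every `t`, `U`: the hopping term has no diagonal matrix elements in the occupation basis and
the interaction counts the doubly occupied sites. -/
theorem star_single_pairSet_self_hamiltonian (t U : ℝ) (A : Finset Λ) :
    (star (Pi.single (pairSet A A) (1 : ℂ)) ⬝ᵥ
      (hamiltonian G t U *ᵥ Pi.single (pairSet A A) 1)).re = U * A.card := by
  rw [Literature.Computability.AlgebraicComplexity.star_single_dotProduct_mulVec_single,
    DoubleOccupancy.hamiltonian_eq_add_smul G t 0 U, sub_zero, Matrix.add_apply, Matrix.smul_apply,
    sum_numberOp_mul_numberOp_eq_diagonal, @Matrix.diagonal_apply_eq _ _ (_)]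
  have hd : doublyOccupied (pairSet A A) = A := by
    ext x
    rw [mem_doublyOccupied, orb_zero_mem_pairSet, orb_one_mem_pairSet, and_self_iff]
  have hh : (hamiltonian G t 0) (pairSet A A) (pairSet A A) = 0 := by
    unfold hamiltonian
    simp only [Matrix.add_apply, Matrix.smul_apply, Matrix.sum_apply, Complex.ofReal_zero,
      zero_smul]
    rw [Finset.sum_eq_zero fun x _ => Finset.sum_eq_zero fun y _ =>
      Finset.sum_eq_zero fun σ _ => ?_]
    · simp
    · split_ifs with hxy
      · exact creation_mul_annihilation_apply_self_eq_zero
          (fun h => G.ne_of_adj hxy (orb_inj.1 h).1) _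
      · rfl
  rw [hh, hd]
  simp

/-- **Upper bracket `E(U; 2m, S^z = 0) ≤ U m`** on any graph (`m ≤ |Λ|`, every `t`, `U`): the
fully paired trial vector `|A↑ ∪ A↓⟩`, `#A = m`, in the variational principle. -/
theorem minEnergyOn_szSector_two_mul_le (t U : ℝ) {m : ℕ} (hm : m ≤ Fintype.card Λ) :
    (hamiltonian G t U).minEnergyOn (szSector (2 * m) 0) ≤ U * m := by
  classical
  have hcard : m ≤ (Finset.univ : Finset Λ).card := by rwa [Finset.card_univ]
  obtain ⟨A, -, hA⟩ := Finset.exists_subset_card_eq hcard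
  have hmem : (Pi.single (pairSet A A) (1 : ℂ) : Fock (Orb Λ)) ∈
      szSector (Λ := Λ) (2 * m) 0 := by
    rw [mem_szSector_two_mul_zero_iff]
    intro s hs
    by_cases hs0 : s = pairSet A A
    · subst hs0
      exact absurd ⟨by rw [upPart_pairSet, hA], by rw [downPart_pairSet, hA]⟩ hs
    · simp [hs0]
  have h1 : star (Pi.single (pairSet A A) (1 : ℂ) : Fock (Orb Λ)) ⬝ᵥ
      Pi.single (pairSet A A) 1 = 1 :=
    Literature.Computability.AlgebraicComplexity.star_single_dotProduct_single _
  have hle :=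
    minEnergyOn_le_rayleigh_of_mem (LiebThm1.hamiltonian_isHermitian G t U) _ hmem h1
  rw [star_single_pairSet_self_hamiltonian G t U A, hA] at hle
  exact hle

/-- **Parametric kinetic ceiling (any bounded-degree graph).** `ω ≥ 1` with
`|t| Δ (2ω - 2ω⁻¹) ≥ -U/2`, `m ≤ |Λ|`: every unit ground state `ψ` of `H(t,U)` in the sector
`(2m, S^z = 0)` has `⟨-T⟩_ψ = -Re⟨ψ, H(t,0)ψ⟩ ≤ m (4|t| Δ ω + U)`. Proof: with
`k = ⟨-T⟩_ψ`, `d = ⟨D⟩_ψ`: `E(U) = -k + U d ≤ U m` (paired configuration) and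
`-|t| Δ ω (2m) ≤ E(U/2) ≤ -k + (U/2) d` (pair-breaking floor at `U/2`, Rayleigh–Ritz with `ψ`);
`2 × (second) + (first)` eliminates `d`. (Intended for `U < 0`; vacuous-but-true otherwise.) -/
theorem neg_re_expect_hopping_le_of_weight {Δ : ℕ}
    (hΔ : ∀ v : Λ, (Finset.univ.filter (G.Adj v)).card ≤ Δ) {t U ω : ℝ} (hω : 1 ≤ ω)
    (hUω : -(U / 2) ≤ |t| * Δ * (2 * ω - 2 * ω⁻¹)) {m : ℕ} (hm : m ≤ Fintype.card Λ)
    {ψ : Fock (Orb Λ)} (hgs : IsGroundStateInSector (hamiltonian G t U) (2 * m) 0 ψ)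
    (h1 : star ψ ⬝ᵥ ψ = 1) :
    -(star ψ ⬝ᵥ (hamiltonian G t 0 *ᵥ ψ)).re ≤ m * (4 * |t| * Δ * ω + U) := by
  set k : ℝ := -(star ψ ⬝ᵥ (hamiltonian G t 0 *ᵥ ψ)).re with hk
  set d : ℝ := (star ψ ⬝ᵥ ((∑ x : Λ, numberOp x 0 * numberOp x 1) *ᵥ ψ)).re with hd
  have hsplit : ∀ U' : ℝ, (star ψ ⬝ᵥ (hamiltonian G t U' *ᵥ ψ)).re = -k + U' * d := by
    intro U'
    rw [DoubleOccupancy.hamiltonian_eq_add_smul G t 0 U', sub_zero, add_mulVec, smul_mulVec,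
      dotProduct_add, dotProduct_smul, Complex.add_re, smul_eq_mul, Complex.re_ofReal_mul, hk,
      hd]
    ring
  -- upper bracket at `U`
  have hup : -k + U * d ≤ U * m := by
    rw [← hsplit U, re_expect_eq_minEnergyOn_of_isGroundStateInSector hgs h1]
    exact minEnergyOn_szSector_two_mul_le G t U hm
  -- floor at `U/2`, tested on `ψ`
  have hlow : -(|t| * Δ * ω * ((2 * m : ℕ) : ℝ)) ≤ -k + U / 2 * d := by
    rw [← hsplit (U / 2)]
    refine (pairBreaking_le_minEnergyOn_szSector G hΔ hω hUω (2 * m) 0 ⟨ψ, hgs.1, h1⟩).trans ?_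
    exact minEnergyOn_le_rayleigh_of_mem (LiebThm1.hamiltonian_isHermitian G t (U / 2)) _
      hgs.1 h1
  push_cast at hlow
  nlinarith [hup, hlow]

/-- **Closed form: `⟨-T⟩_ψ ≤ 16 Δ² t² m/|U|` on any graph of maximal degree `≤ Δ`** (`t ≠ 0`,
`Δ > 0`, `U < 0`, `m ≤ |Λ|`, `ψ` a unit ground state of the sector `(2m, S^z = 0)`): the parametric
ceiling with `ω = a + a⁻¹`, `a = |U|/(4|t|Δ)`, for which `4|t|Δω + U = 16 Δ² t²/|U|`. -/
theorem neg_re_expect_hopping_le_attractive_graph {Δ : ℕ}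
    (hΔ : ∀ v : Λ, (Finset.univ.filter (G.Adj v)).card ≤ Δ) (hΔ0 : 0 < Δ) {t U : ℝ}
    (ht : t ≠ 0) (hU : U < 0) {m : ℕ} (hm : m ≤ Fintype.card Λ) {ψ : Fock (Orb Λ)}
    (hgs : IsGroundStateInSector (hamiltonian G t U) (2 * m) 0 ψ) (h1 : star ψ ⬝ᵥ ψ = 1) :
    -(star ψ ⬝ᵥ (hamiltonian G t 0 *ᵥ ψ)).re ≤ 16 * (Δ : ℝ) ^ 2 * t ^ 2 * m / (-U) := by
  have htΔ : 0 < |t| * Δ := mul_pos (abs_pos.2 ht) (by exact_mod_cast hΔ0)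
  set a : ℝ := -U / (4 * (|t| * Δ)) with ha_def
  have ha : 0 < a := by rw [ha_def]; exact div_pos (by linarith) (by linarith)
  obtain ⟨hω1, hωa⟩ := one_le_add_inv_and_le_sub_inv ha
  have hUω : -(U / 2) ≤ |t| * Δ * (2 * (a + a⁻¹) - 2 * (a + a⁻¹)⁻¹) := by
    have h4 : 4 * (|t| * Δ) * a = -U := by
      rw [ha_def]; field_simp
    nlinarith [hωa, htΔ.le]
  have h := neg_re_expect_hopping_le_of_weight G hΔ hω1 hUω hm hgs h1
  have hval :
      (m : ℝ) * (4 * |t| * Δ * (a + a⁻¹) + U) = 16 * (Δ : ℝ) ^ 2 * t ^ 2 * m / (-U) := by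
    have hU0 : (-U) ≠ 0 := by linarith
    rw [ha_def, ← sq_abs t]
    field_simp
    ring
  linarith [hval]

end Graph

/-- **Density-proportional kinetic ceiling for the attractive Hubbard model on ANY
bounded-degree graph (PROVED below).** For every finite simple graph of maximal degree `≤ Δ`
(`Δ > 0`), every `t ≠ 0`, `U < 0`, `m ≤ |Λ|`, every unit ground state `ψ` of `H(t,U)` in the
sector `(2m, S^z = 0)`: `⟨-T⟩_ψ = -Re⟨ψ, H(t,0)ψ⟩ ≤ 16 Δ² t² m/|U|` (`= 8 Δ² t² N/|U|`).
Informative only for `|U| > 8Δ|t|`; constant loose by `≈ 4Δ` against second-order perturbation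
theory. -/
@[conjecture] def AttractiveKineticCeilingGraph : Prop :=
  ∀ (Λ : Type) [LinearOrder Λ] [Fintype Λ] (G : SimpleGraph Λ) [DecidableRel G.Adj] (Δ : ℕ),
    (∀ v : Λ, (Finset.univ.filter (G.Adj v)).card ≤ Δ) → 0 < Δ →
    ∀ (t U : ℝ) (m : ℕ) (ψ : Fock (Orb Λ)), t ≠ 0 → U < 0 → m ≤ Fintype.card Λ →
      IsGroundStateInSector (hamiltonian G t U) (2 * m) 0 ψ → star ψ ⬝ᵥ ψ = 1 →
      -(star ψ ⬝ᵥ (hamiltonian G t 0 *ᵥ ψ)).re ≤ 16 * (Δ : ℝ) ^ 2 * t ^ 2 * m / (-U)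

/-- Proof of `AttractiveKineticCeilingGraph`. -/
theorem attractiveKineticCeilingGraph_holds : AttractiveKineticCeilingGraph := by
  intro Λ _ _ G _ Δ hΔ hΔ0 t U m ψ ht hU hm hgs h1
  exact neg_re_expect_hopping_le_attractive_graph G hΔ hΔ0 ht hU hm hgs h1

/-- **Consistency with the square torus** (`Δ = 4`, `t = 1`, `|Λ| = L²`): every unit ground state
of `hubbardTorus 2 L 1 U`, `U < 0`, in the sector `(2m, S^z = 0)`, `m ≤ L²`, has
`-Re⟨ψ, H(1,0)ψ⟩ ≤ 256 m/|U|` — the constant of `AttractiveKineticCeilingDensity`. -/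
theorem neg_re_expect_hopping_le_attractive_torus {L : ℕ} [NeZero L] {U : ℝ} (hU : U < 0)
    {m : ℕ} (hm : m ≤ L ^ 2) {ψ : Fock (Orb (FermionTorus 2 L))}
    (hgs : IsGroundStateInSector (hubbardTorus 2 L 1 U) (2 * m) 0 ψ) (h1 : star ψ ⬝ᵥ ψ = 1) :
    -(star ψ ⬝ᵥ (hubbardTorus 2 L 1 0 *ᵥ ψ)).re ≤ 256 * m / (-U) := by
  have hΔ : ∀ v : FermionTorus 2 L,
      (Finset.univ.filter ((fermionTorusGraph 2 L).Adj v)).card ≤ 4 := fun v =>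
    (card_filter_fermionTorusGraph_adj_le v).trans (by norm_num)
  have hm' : m ≤ Fintype.card (FermionTorus 2 L) := by rwa [NoGo.card_fermionTorus_two]
  have h := neg_re_expect_hopping_le_attractive_graph (fermionTorusGraph 2 L) hΔ
    (by norm_num) one_ne_zero hU hm' (by rwa [hubbardTorus] at hgs) h1
  rw [hubbardTorus]
  refine h.trans (le_of_eq ?_)
  push_cast
  ring

end Summit.HubbardSuperconductivity.HubbardLadder.Bounds

end
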